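import Literature.IUT.HodgeArakelov.AbsTopMonoidsGenuineGhat
import HarnessLib

/-!
# [IUTchII] Example 1.8 (vii) `(∗ĝp)` GENUINE, part 2: transports of `O^ĝp(G) = lim→_J ((k̄^×)^J)^∧` along EQUIVARIANT
# automorphisms of `k̄^×`, and the `G_k`-action

S. Mochizuki, *Inter-universal Teichmüller theory II*, §1, Example 1.8 (vii) p. 40 ("`(G ↷ O^ĝp(G))` … compatible with a
natural action of `Γ`"), Remark 1.11.1 (i) (b)(c) p. 50 ("the [`G`-linear] automorphisms … determined by the natural action of
`Ẑ^×`") [claim: Mochizuki2012, status: disputed] (IUTchII §1 Ex 1.8 (vii), kurims p.40).  abc-iut cell, layer L6, row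
«GHATGP-GENUINE», STAGE 1c (seat abc-iut-L6-d2 gen 6; post-freeze def, reading (ii)); sequel of `AbsTopMonoidsGenuineGhat.lean`.

For a topological automorphism `φ` of `Gal(k̄/k)` and a `φ`-EQUIVARIANT multiplicative automorphism `τ` of `k̄^×`
(`Genuine.IsEquivariantUnits C φ τ`: `τ(σ x) = φ(σ)(τ x)`), `τ` maps the `J`-invariants onto the `φ(J)`-invariants
(`tau_mem_fixedUnits_transport`; `GhatLevel.transport` = `φ(J)`, open), hence induces levelwise `PowCompletion.map`s compatible
with the transition maps and so an endomorphism of the direct limit: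

* `Genuine.transportOghat C φ τ hτ : O^ĝp →* O^ĝp` with **`transportOghat_toOghat : τ̂ (η x) = η (τ x)`** and
  **`transportOghat_zhatPowOghat`** (commutes with the `Ẑ^×`-action — naturality of `PowCompletion.zhatPow`);
  composition / identity on generators (`transportOghat_comp_apply`, `transportOghat_id_apply`) and the AUTOMORPHISM
  `Genuine.transportOghatEquiv C hτ : O^ĝp ≃* O^ĝp` (inverse along `(φ⁻¹, τ⁻¹)`);
* the case `τ = σ ∈ Gal(k̄/k)` itself, `φ =` conjugation by `σ` (`conjAut`, `isEquivariantUnits_gal`):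
  **`Genuine.galActOghat C : Gal(k̄/k) →* MulAut O^ĝp`** — THE `G_k`-ACTION on `O^ĝp(G_k)` (levelwise
  `(k̄^×)^J ⥲ (k̄^×)^{σJσ⁻¹}`), extending the Galois action on `k̄^×` along `η` (`galActOghat_toOghat`) and COMMUTING with
  `Ẑ^×` (`galActOghat_zhatPowOghat` — the `Ẑ^×`-action is `G`-linear: clause 3 of abc-iut-L6-t1's `Rmk1111_c` in substance).
The other instance — `τ =` the groupification of THE lift `liftM(φ)` of a topological automorphism `φ` of `G_k`
([IUTchII] Ex. 1.8 (ii); the `Aut(G)`-transport needed for clause 1 of `Rmk1111_c`) — is taken in the sequel.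

HONEST FRAMING: classical algebra over OUR typed objects; nothing here bears on [IUTchIII] Cor. 3.12; typed ≠ proved elsewhere.
-/

noncomputable section

namespace Literature.IUT.HodgeArakelov

open CategoryTheory
open Literature.AnabelianGeometry.AbsoluteAnabelian

namespace AbsTopMonoids.Genuine

variable (C : MLFClosure.{0})

/-! ## Transport along EQUIVARIANT multiplicative automorphisms of `k̄^×`

For a topological automorphism `φ` of `Gal(k̄/k)` and a `φ`-equivariant multiplicative automorphism `τ` of `k̄^×`
(`τ(σ x) = φ(σ)(τ x)`), `τ` carries the `J`-invariants onto the `φ(J)`-invariants, hence induces an automorphism of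
`O^ĝp`.  Instances: `σ ∈ Gal(k̄/k)` itself (`φ =` conjugation by `σ`) — the `G`-ACTION on `O^ĝp(G)` —, and (in the
sequel) the groupification of THE lift `liftM(φ)` of [IUTchII] Ex. 1.8 (ii) — the `Aut(G)`-transport. -/

/-- `γ ∈ Gal(k̄/k)` acting on `k̄^×`. [claim: Mochizuki2012, status: disputed] (IUTchII §1 Ex 1.8 (vii), kurims p.40) -/
def galUnits (γ : C.K ≃ₐ[C.k] C.K) : (C.K)ˣ →* (C.K)ˣ := Units.map (γ : C.K →* C.K)

/-- `coe_galUnits` (structure lemma of the genuine `(∗ĝp)` construction). [claim: Mochizuki2012, status: disputed] (IUTchII §1 Ex 1.8 (vii), kurims p.40) -/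
@[simp] theorem coe_galUnits (γ : C.K ≃ₐ[C.k] C.K) (x : (C.K)ˣ) : ((galUnits C γ x : (C.K)ˣ) : C.K) = γ x := rfl

/-- `σ ∈ Gal(k̄/k)` as an automorphism of `k̄^×`. [claim: Mochizuki2012, status: disputed] (IUTchII §1 Ex 1.8 (vii), kurims p.40) -/
def galUnitsEquiv (σ : C.K ≃ₐ[C.k] C.K) : (C.K)ˣ ≃* (C.K)ˣ := Units.mapEquiv (σ : C.K ≃* C.K)

/-- `coe_galUnitsEquiv` (structure lemma of the genuine `(∗ĝp)` construction). [claim: Mochizuki2012, status: disputed] (IUTchII §1 Ex 1.8 (vii), kurims p.40) -/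
@[simp] theorem coe_galUnitsEquiv (σ : C.K ≃ₐ[C.k] C.K) (x : (C.K)ˣ) :
    ((galUnitsEquiv C σ x : (C.K)ˣ) : C.K) = σ x := rfl

/-- `φ`-EQUIVARIANCE of a multiplicative automorphism `τ` of `k̄^×`: `τ(σ x) = φ(σ)(τ x)`. [claim: Mochizuki2012, status: disputed] (IUTchII §1 Ex 1.8 (vii), kurims p.40) -/
def IsEquivariantUnits (φ : (C.K ≃ₐ[C.k] C.K) ≃ₜ* (C.K ≃ₐ[C.k] C.K)) (τ : (C.K)ˣ ≃* (C.K)ˣ) : Prop :=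
  ∀ (σ : C.K ≃ₐ[C.k] C.K) (x : (C.K)ˣ), τ (galUnits C σ x) = galUnits C (φ σ) (τ x)

section Transport

variable (φ : (C.K ≃ₐ[C.k] C.K) ≃ₜ* (C.K ≃ₐ[C.k] C.K)) (τ : (C.K)ˣ ≃* (C.K)ˣ) (hτ : IsEquivariantUnits C φ τ)

/-- The level `φ(J)` (an open subgroup, `φ` being a homeomorphism). [claim: Mochizuki2012, status: disputed] (IUTchII §1 Ex 1.8 (vii), kurims p.40) -/
def GhatLevel.transport (i : GhatLevel C) : GhatLevel C :=
  ⟨i.J.comap (φ.symm : (C.K ≃ₐ[C.k] C.K) →* (C.K ≃ₐ[C.k] C.K)) φ.symm.continuous⟩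

/-- `GhatLevel.mem_transport_iff` (structure lemma of the genuine `(∗ĝp)` construction). [claim: Mochizuki2012, status: disputed] (IUTchII §1 Ex 1.8 (vii), kurims p.40) -/
theorem GhatLevel.mem_transport_iff (i : GhatLevel C) (σ : C.K ≃ₐ[C.k] C.K) :
    σ ∈ ((GhatLevel.transport C φ i).J : Subgroup (C.K ≃ₐ[C.k] C.K)) ↔ φ.symm σ ∈ (i.J : Subgroup (C.K ≃ₐ[C.k] C.K)) :=
  Iff.rfl

/-- `GhatLevel.transport_mono` (structure lemma of the genuine `(∗ĝp)` construction). [claim: Mochizuki2012, status: disputed] (IUTchII §1 Ex 1.8 (vii), kurims p.40) -/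
theorem GhatLevel.transport_mono {i j : GhatLevel C} (h : i ≤ j) :
    GhatLevel.transport C φ i ≤ GhatLevel.transport C φ j :=
  fun σ hσ => (GhatLevel.mem_transport_iff C φ i σ).mpr (h ((GhatLevel.mem_transport_iff C φ j σ).mp hσ))

include hτ in
/-- An equivariant `τ` maps `J`-invariant units to `φ(J)`-invariant units. [claim: Mochizuki2012, status: disputed] (IUTchII §1 Ex 1.8 (vii), kurims p.40) -/
theorem tau_mem_fixedUnits_transport (i : GhatLevel C) (x : (C.K)ˣ)
    (hx : x ∈ fixedUnits C (i.J : Subgroup (C.K ≃ₐ[C.k] C.K))) :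
    τ x ∈ fixedUnits C ((GhatLevel.transport C φ i).J : Subgroup (C.K ≃ₐ[C.k] C.K)) := by
  intro σ hσ
  have hσ' := (GhatLevel.mem_transport_iff C φ i σ).mp hσ
  have h1 : galUnits C (φ.symm σ) x = x := Units.ext (hx _ hσ')
  have h2 := hτ (φ.symm σ) x
  rw [h1, ContinuousMulEquiv.apply_symm_apply] at h2
  exact (congrArg (fun w : (C.K)ˣ => (w : C.K)) h2).symm

/-- `τ` on the level groups `(k̄^×)^J → (k̄^×)^{φ(J)}`. [claim: Mochizuki2012, status: disputed] (IUTchII §1 Ex 1.8 (vii), kurims p.40) -/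
def levelTau (i : GhatLevel C) :
    fixedUnits C (i.J : Subgroup (C.K ≃ₐ[C.k] C.K)) →* fixedUnits C ((GhatLevel.transport C φ i).J : Subgroup (C.K ≃ₐ[C.k] C.K)) where
  toFun x := ⟨τ x, tau_mem_fixedUnits_transport C φ τ hτ i x x.2⟩
  map_one' := Subtype.ext (by simp)
  map_mul' x y := Subtype.ext (by simp)

/-- `coe_levelTau` (structure lemma of the genuine `(∗ĝp)` construction). [claim: Mochizuki2012, status: disputed] (IUTchII §1 Ex 1.8 (vii), kurims p.40) -/
@[simp] theorem coe_levelTau (i : GhatLevel C) (x : fixedUnits C (i.J : Subgroup (C.K ≃ₐ[C.k] C.K))) :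
    ((levelTau C φ τ hτ i x : fixedUnits C _) : (C.K)ˣ) = τ x := rfl

/-- Level `J` composed with `τ̂`, as a map into `O^ĝp`. [claim: Mochizuki2012, status: disputed] (IUTchII §1 Ex 1.8 (vii), kurims p.40) -/
def transportLevelHom (i : GhatLevel C) : levelGroup C i →* Oghat C :=
  (ofLevel C (GhatLevel.transport C φ i)).comp (PowCompletion.map (levelTau C φ τ hτ i))

/-- `transportLevelHom_compat` (structure lemma of the genuine `(∗ĝp)` construction). [claim: Mochizuki2012, status: disputed] (IUTchII §1 Ex 1.8 (vii), kurims p.40) -/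
theorem transportLevelHom_compat (i j : GhatLevel C) (h : i ≤ j) (x : levelGroup C i) :
    transportLevelHom C φ τ hτ i x = transportLevelHom C φ τ hτ j (levelMap C i j h x) := by
  have key : (levelMap C _ _ (GhatLevel.transport_mono C φ h)).comp (PowCompletion.map (levelTau C φ τ hτ i)) =
      (PowCompletion.map (levelTau C φ τ hτ j)).comp (levelMap C i j h) := by
    change (PowCompletion.map _).comp (PowCompletion.map _) = (PowCompletion.map _).comp (PowCompletion.map _)
    rw [← PowCompletion.map_comp, ← PowCompletion.map_comp]
    exact PowCompletion.map_congr fun a => Subtype.ext rfl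
  change ofLevel C _ (PowCompletion.map _ x) = ofLevel C _ (PowCompletion.map _ (levelMap C i j h x))
  rw [← ofLevel_levelMap C (GhatLevel.transport_mono C φ h), ← MonoidHom.comp_apply (levelMap C _ _ _), key,
    MonoidHom.comp_apply]

/-- **The transport `τ̂ : O^ĝp → O^ĝp`** along a `φ`-equivariant automorphism `τ` of `k̄^×` (a group endomorphism;
an automorphism with inverse the transport along `(φ⁻¹, τ⁻¹)`, `transportOghatEquiv`).
[claim: Mochizuki2012, status: disputed] (IUTchII §1 Ex 1.8 (vii), kurims p.40) -/
def transportOghat : Oghat C →* Oghat C where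
  toFun := DirectLimit.lift (levelMap C) (fun i => ⇑(transportLevelHom C φ τ hτ i)) (transportLevelHom_compat C φ τ hτ)
  map_one' := DirectLimit.lift_one (f := levelMap C) (transportLevelHom C φ τ hτ ·) (transportLevelHom_compat C φ τ hτ)
  map_mul' := DirectLimit.lift_mul (f := levelMap C) (transportLevelHom C φ τ hτ ·) (transportLevelHom_compat C φ τ hτ)

/-- `transportOghat_ofLevel` (structure lemma of the genuine `(∗ĝp)` construction). [claim: Mochizuki2012, status: disputed] (IUTchII §1 Ex 1.8 (vii), kurims p.40) -/
theorem transportOghat_ofLevel (i : GhatLevel C) (x : levelGroup C i) :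
    transportOghat C φ τ hτ (ofLevel C i x) =
      ofLevel C (GhatLevel.transport C φ i) (PowCompletion.map (levelTau C φ τ hτ i) x) := rfl

/-- `τ̂ (η x) = η (τ x)`: the transport extends `τ` along `η : k̄^× → O^ĝp`. [claim: Mochizuki2012, status: disputed] (IUTchII §1 Ex 1.8 (vii), kurims p.40) -/
theorem transportOghat_toOghat (x : (C.K)ˣ) : transportOghat C φ τ hτ (toOghat C x) = toOghat C (τ x) := by
  rw [toOghat_eq_ofLevel C x (levelOf C x) (mem_fixedUnits_levelOf C x), transportOghat_ofLevel, PowCompletion.map_of,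
    toOghat_eq_ofLevel C (τ x) (GhatLevel.transport C φ (levelOf C x))
      (tau_mem_fixedUnits_transport C φ τ hτ _ x (mem_fixedUnits_levelOf C x))]
  rfl

/-- The transport commutes with the `Ẑ^×`-action. [claim: Mochizuki2012, status: disputed] (IUTchII §1 Ex 1.8 (vii), kurims p.40) -/
theorem transportOghat_zhatPowOghat (u : ZHatUnits) (z : Oghat C) :
    transportOghat C φ τ hτ (zhatPowOghat C u z) = zhatPowOghat C u (transportOghat C φ τ hτ z) := by
  induction z using DirectLimit.induction with
  | ih i x =>
    change transportOghat C φ τ hτ (zhatPowOghat C u (ofLevel C i x)) = zhatPowOghat C u (transportOghat C φ τ hτ (ofLevel C i x))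
    rw [zhatPowOghat_ofLevel, transportOghat_ofLevel, transportOghat_ofLevel, zhatPowOghat_ofLevel, PowCompletion.map_zhatPow]

end Transport

/-- Transports compose: the transport along `(φ₂ ∘ φ₁, τ₂ ∘ τ₁)` is the composite of the transports. [claim: Mochizuki2012, status: disputed] (IUTchII §1 Ex 1.8 (vii), kurims p.40) -/
theorem transportOghat_comp_apply
    {φ₁ φ₂ φ : (C.K ≃ₐ[C.k] C.K) ≃ₜ* (C.K ≃ₐ[C.k] C.K)} {τ₁ τ₂ τ : (C.K)ˣ ≃* (C.K)ˣ}
    (h₁ : IsEquivariantUnits C φ₁ τ₁) (h₂ : IsEquivariantUnits C φ₂ τ₂) (h : IsEquivariantUnits C φ τ)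
    (hφ : ∀ σ, φ σ = φ₂ (φ₁ σ)) (hτ : ∀ x, τ x = τ₂ (τ₁ x)) (z : Oghat C) :
    transportOghat C φ τ h z = transportOghat C φ₂ τ₂ h₂ (transportOghat C φ₁ τ₁ h₁ z) := by
  induction z using DirectLimit.induction with
  | ih i x =>
    change transportOghat C φ τ h (ofLevel C i x) = transportOghat C φ₂ τ₂ h₂ (transportOghat C φ₁ τ₁ h₁ (ofLevel C i x))
    rw [transportOghat_ofLevel, transportOghat_ofLevel, transportOghat_ofLevel]
    -- the target levels `φ(J)` and `φ₂(φ₁(J))` coincide as subgroups; compare at the latter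
    have hle : GhatLevel.transport C φ i ≤ GhatLevel.transport C φ₂ (GhatLevel.transport C φ₁ i) := by
      intro σ hσ
      rw [GhatLevel.mem_transport_iff] at hσ ⊢
      rw [GhatLevel.mem_transport_iff] at hσ
      have : φ.symm σ = φ₁.symm (φ₂.symm σ) := by
        apply φ.injective
        rw [ContinuousMulEquiv.apply_symm_apply, hφ, ContinuousMulEquiv.apply_symm_apply,
          ContinuousMulEquiv.apply_symm_apply]
      rwa [this]
    rw [← ofLevel_levelMap C hle]
    congr 1
    change PowCompletion.map _ (PowCompletion.map _ x) = PowCompletion.map _ (PowCompletion.map _ x)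
    rw [← MonoidHom.comp_apply (PowCompletion.map _), ← PowCompletion.map_comp,
      ← MonoidHom.comp_apply (PowCompletion.map _), ← PowCompletion.map_comp]
    exact congrFun (congrArg DFunLike.coe
      (PowCompletion.map_congr fun a => Subtype.ext (by simp [hτ]))) x

/-- The transport along data acting as the identity is the identity. [claim: Mochizuki2012, status: disputed] (IUTchII §1 Ex 1.8 (vii), kurims p.40) -/
theorem transportOghat_id_apply {φ : (C.K ≃ₐ[C.k] C.K) ≃ₜ* (C.K ≃ₐ[C.k] C.K)} {τ : (C.K)ˣ ≃* (C.K)ˣ}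
    (h : IsEquivariantUnits C φ τ) (hφ : ∀ σ, φ σ = σ) (hτ : ∀ x, τ x = x) (z : Oghat C) :
    transportOghat C φ τ h z = z := by
  induction z using DirectLimit.induction with
  | ih i x =>
    change transportOghat C φ τ h (ofLevel C i x) = ofLevel C i x
    rw [transportOghat_ofLevel]
    have hle : i ≤ GhatLevel.transport C φ i := by
      intro σ hσ
      rw [GhatLevel.mem_transport_iff] at hσ
      have : φ.symm σ = σ := by
        apply φ.injective
        rw [ContinuousMulEquiv.apply_symm_apply, hφ]
      rwa [this] at hσ
    rw [← ofLevel_levelMap C hle]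
    congr 1
    exact congrFun (congrArg DFunLike.coe (PowCompletion.map_congr fun a => Subtype.ext (by simp [hτ]))) x

/-- `IsEquivariantUnits.symm` (structure lemma of the genuine `(∗ĝp)` construction). [claim: Mochizuki2012, status: disputed] (IUTchII §1 Ex 1.8 (vii), kurims p.40) -/
theorem IsEquivariantUnits.symm {φ : (C.K ≃ₐ[C.k] C.K) ≃ₜ* (C.K ≃ₐ[C.k] C.K)} {τ : (C.K)ˣ ≃* (C.K)ˣ}
    (h : IsEquivariantUnits C φ τ) : IsEquivariantUnits C φ.symm τ.symm := by
  intro σ x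
  apply τ.injective
  rw [MulEquiv.apply_symm_apply, h, ContinuousMulEquiv.apply_symm_apply, MulEquiv.apply_symm_apply]

/-- `IsEquivariantUnits.refl` (structure lemma of the genuine `(∗ĝp)` construction). [claim: Mochizuki2012, status: disputed] (IUTchII §1 Ex 1.8 (vii), kurims p.40) -/
theorem IsEquivariantUnits.refl : IsEquivariantUnits C (ContinuousMulEquiv.refl _) (MulEquiv.refl _) :=
  fun _ _ => rfl

/-- **The transport as an AUTOMORPHISM of `O^ĝp`** (inverse: the transport along `(φ⁻¹, τ⁻¹)`).
[claim: Mochizuki2012, status: disputed] (IUTchII §1 Ex 1.8 (vii), kurims p.40) -/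
def transportOghatEquiv {φ : (C.K ≃ₐ[C.k] C.K) ≃ₜ* (C.K ≃ₐ[C.k] C.K)} {τ : (C.K)ˣ ≃* (C.K)ˣ}
    (h : IsEquivariantUnits C φ τ) : Oghat C ≃* Oghat C where
  toFun := transportOghat C φ τ h
  invFun := transportOghat C φ.symm τ.symm h.symm
  left_inv z := by
    rw [← transportOghat_comp_apply C h h.symm (IsEquivariantUnits.refl C) (fun σ => by simp) (fun x => by simp) z]
    exact transportOghat_id_apply C _ (fun σ => rfl) (fun x => rfl) z
  right_inv z := by
    rw [← transportOghat_comp_apply C h.symm h (IsEquivariantUnits.refl C) (fun σ => by simp) (fun x => by simp) z]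
    exact transportOghat_id_apply C _ (fun σ => rfl) (fun x => rfl) z
  map_mul' := map_mul _

/-- `transportOghatEquiv_apply` (structure lemma of the genuine `(∗ĝp)` construction). [claim: Mochizuki2012, status: disputed] (IUTchII §1 Ex 1.8 (vii), kurims p.40) -/
@[simp] theorem transportOghatEquiv_apply {φ : (C.K ≃ₐ[C.k] C.K) ≃ₜ* (C.K ≃ₐ[C.k] C.K)} {τ : (C.K)ˣ ≃* (C.K)ˣ}
    (h : IsEquivariantUnits C φ τ) (z : Oghat C) :
    transportOghatEquiv C h z = transportOghat C φ τ h z := rfl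

/-! ## The `G_k`-action on `O^ĝp`: transport along `σ` itself -/

/-- Conjugation by `σ` as a topological automorphism of `Gal(k̄/k)`. [claim: Mochizuki2012, status: disputed] (IUTchII §1 Ex 1.8 (vii), kurims p.40) -/
def conjAut (σ : C.K ≃ₐ[C.k] C.K) : (C.K ≃ₐ[C.k] C.K) ≃ₜ* (C.K ≃ₐ[C.k] C.K) :=
  { MulAut.conj σ with
    continuous_toFun := (continuous_const.mul continuous_id).mul continuous_const
    continuous_invFun := (continuous_const.mul continuous_id).mul continuous_const }

/-- `conjAut_apply` (structure lemma of the genuine `(∗ĝp)` construction). [claim: Mochizuki2012, status: disputed] (IUTchII §1 Ex 1.8 (vii), kurims p.40) -/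
@[simp] theorem conjAut_apply (σ γ : C.K ≃ₐ[C.k] C.K) : conjAut C σ γ = σ * γ * σ⁻¹ := rfl

/-- `isEquivariantUnits_gal` (structure lemma of the genuine `(∗ĝp)` construction). [claim: Mochizuki2012, status: disputed] (IUTchII §1 Ex 1.8 (vii), kurims p.40) -/
theorem isEquivariantUnits_gal (σ : C.K ≃ₐ[C.k] C.K) : IsEquivariantUnits C (conjAut C σ) (galUnitsEquiv C σ) := by
  intro γ x
  apply Units.ext
  simp only [coe_galUnitsEquiv, coe_galUnits, conjAut_apply, AlgEquiv.mul_apply, AlgEquiv.aut_inv,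
    AlgEquiv.symm_apply_apply]

/-- **The `G_k`-action on `O^ĝp(G_k)`**: `σ ↦ σ̂`, the transport along `σ : k̄^× ⥲ k̄^×` (levelwise `(k̄^×)^J ⥲ (k̄^×)^{σJσ⁻¹}`).
[claim: Mochizuki2012, status: disputed] (IUTchII §1 Ex 1.8 (vii), kurims p.40) -/
def galActOghat : (C.K ≃ₐ[C.k] C.K) →* MulAut (Oghat C) where
  toFun σ := transportOghatEquiv C (isEquivariantUnits_gal C σ)
  map_one' := MulEquiv.ext fun z =>
    transportOghat_id_apply C _ (fun γ => by simp) (fun x => Units.ext (by simp)) z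
  map_mul' σ σ' := MulEquiv.ext fun z =>
    transportOghat_comp_apply C (isEquivariantUnits_gal C σ') (isEquivariantUnits_gal C σ) _
      (fun γ => by simp [mul_assoc]) (fun x => Units.ext (by simp)) z

/-- `galActOghat_apply` (structure lemma of the genuine `(∗ĝp)` construction). [claim: Mochizuki2012, status: disputed] (IUTchII §1 Ex 1.8 (vii), kurims p.40) -/
theorem galActOghat_apply (σ : C.K ≃ₐ[C.k] C.K) (z : Oghat C) :
    galActOghat C σ z = transportOghat C (conjAut C σ) (galUnitsEquiv C σ) (isEquivariantUnits_gal C σ) z := rfl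

/-- `galActOghat_toOghat` (structure lemma of the genuine `(∗ĝp)` construction). [claim: Mochizuki2012, status: disputed] (IUTchII §1 Ex 1.8 (vii), kurims p.40) -/
theorem galActOghat_toOghat (σ : C.K ≃ₐ[C.k] C.K) (x : (C.K)ˣ) :
    galActOghat C σ (toOghat C x) = toOghat C (galUnitsEquiv C σ x) := by
  rw [galActOghat_apply]
  exact transportOghat_toOghat C _ _ _ x

/-- The `G_k`-action commutes with the `Ẑ^×`-action (`Ẑ^×` acts `G_k`-LINEARLY on `O^ĝp`).
[claim: Mochizuki2012, status: disputed] (IUTchII §1 Rmk 1.11.1 (i), kurims p.50) -/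
theorem galActOghat_zhatPowOghat (σ : C.K ≃ₐ[C.k] C.K) (u : ZHatUnits) (z : Oghat C) :
    galActOghat C σ (zhatPowOghat C u z) = zhatPowOghat C u (galActOghat C σ z) := by
  rw [galActOghat_apply, galActOghat_apply]
  exact transportOghat_zhatPowOghat C _ _ _ u z

end AbsTopMonoids.Genuine

end Literature.IUT.HodgeArakelov

end
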